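import Summits.QuantumFields.BalabanUV.Beta.FP.AveragingJetLetters

/-!
# `Beta/FP/AveragingJetLettersBounds` — road «FP» (binder row D1), row **RHOA-6b** (part 2 of 3): the ℓ¹ LETTERS of
# the first averaging-jet kernel `q̇(y; b′, b)` of `FP/AveragingJetLetters` (RHOA-DESIGN v1.1 §2bis (q̇), verbatim:
# «`Σ_u |q̇(u;b′,b)| ≤ n⁻⁵·(n−t) ≤ n⁻⁴`; given `b′`, fewer than `n` partners `b` ⟹ the β-insertion operator norm
# letter `n·n⁻⁴ = n⁻³`»)

HONEST FRAMING (cell `pub-balaban`, β sub-cell, verbatim): discharging `BetaPertH` makes Bałaban's UV stability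
UNCONDITIONAL — a real constructive-QFT result; it is NOT the continuum limit and NOT the Clay problem.  THIS MODULE
discharges NOTHING of the series, of row D1, of `hbook`/`hasym`/ρ: [folklore] finite counting on `ℤ⁴` for the cell's
OWN averaging model ([our object] of part 1).  «not in print; our bookkeeping».  0 estimates of any Bałaban propagator.
HONEST DEPENDENCY: continuum YM on T⁴ ⇐ BetaPertH ∧ nine spine estimates (0/9 proved); BetaPertH ⇐ (D1) ∧ (D4) ∧
CAP+tail; G-an2-4 gates asym, D1 and NE2/3/4.

ABSOLUTE RULE (cell charter, verbatim): «No internally-minted statement may enter as a cited fact. Every hypothesis is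
either kernel-proved in this package or a verbatim quotation of a PUBLISHED theorem with page reference. The
manuscript(s) under audit are NOT citable for their own disputed steps — they are the thing under adjudication;
programme-internal (2001/route/tribunal) claims are never citable.»  No `def … : Prop`, no citation, 0 sorry.

WHAT IS TYPED (objects of part 1 BY NAME: `dotIdx`, `dotMap`, `dotFiber`, `dotCount`, `qdot`, `ctrPts`; every letter
is stated for EVERY finite set `S` of blocks / `T` of bonds, so a consumer (row RHOA-6c) may pass to `tsum`/`HasSum`):
* (L0) `dotCount_ne_zero_imp` — SUPPORT: `dotCount n μ y b′ b ≠ 0` forces `b = b′ + t•e_μ` with `0 < t < n`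
  (collinear, forward, length `< n`) and `b′, b ∈ ctrPts n μ y`; zero elsewhere; (L0′) `supNorm_sub_le_of_mem_ctrPts`:
  the LOCALITY RADIUS `‖b − n•y‖∞ ≤ 2n − 2` of `ctrPts n μ y` (row RHOA-6c's «`‖b − n•u‖∞ ≤` radius» letter, radius `2n−2`).
* (L1) `sum_dotCount_le_sub` (`Σ_{y∈S} dotCount ≤ n − t` for `b = b′ + t•e_μ`), `sum_dotCount_le` (`≤ n` always),
  **`sum_qdot_le_sub`** (`Σ_{y∈S} q̇(y; b′, b′+t•e_μ) ≤ (n−t)/n⁵`), **`sum_qdot_le`** (`Σ_{y∈S} q̇(y; b′, b) ≤ 1/n⁴`).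
* (L2) `triPairs n` (`{(j,s) : j < s < n}`), `card_triPairs_mul_two` (`#·2 = n(n−1)`), `card_triPairs_le` (`# ≤ n²/2`);
  `sum_sum_dotCount_le_left/right` (`≤ #triPairs n`), and THE INSERTION OPERATOR-NORM LETTERS
  **`sum_sum_qdot_le_left`** (`b′` fixed: `Σ_{y∈S}Σ_{b∈T} q̇ ≤ 1/(2n³)`), **`sum_sum_qdot_le_right`** (`b` fixed:
  `Σ_{y∈S}Σ_{b′∈T} q̇ ≤ 1/(2n³)`).
MECHANISM: each count is bounded through an INJECTION into `range (n − t)` / `triPairs n` — the position label(s)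
`j` (and `s`) of a summand determine it, because the block index `y` is determined by a fine base point (part 1
`base_unique`) and the position along a contour by the point (part 1 `pt_pos_injective`).  No analysis.
-/

noncomputable section

namespace Summit.QuantumFields.BalabanUV.Beta.FP.AveragingJetLettersBounds

open Finset
open scoped BigOperators
open Literature.MathematicalPhysics.QuantumFieldTheory.Balaban1983to89.Beta
open Literature.MathematicalPhysics.QuantumFieldTheory.Balaban1983to89.Beta.DyadicShell (Pt supNorm supNorm_le_iff)
open Literature.MathematicalPhysics.QuantumFieldTheory.Balaban1983to89.Beta.BubbleTransfer (unitVec)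
open Literature.MathematicalPhysics.QuantumFieldTheory.Balaban1983to89.Beta.AxialBlockWeights
  (fineBlock idx pt mem_fineBlock pt_apply)
open Summit.QuantumFields.BalabanUV.Beta.FP.AveragingJetLetters

/-! ## (L0) Support -/

/-- (L0) SUPPORT: a nonzero `dotCount n μ y b′ b` forces `b = b′ + t•e_μ` with `0 < t < n` (collinear, forward, length
`< n`) and both points among the block's contour points. [folklore] -/
theorem dotCount_ne_zero_imp {n : ℕ} {μ : Fin 4} {y b' b : Pt} (h : dotCount n μ y b' b ≠ 0) :
    (∃ t : ℕ, 0 < t ∧ t < n ∧ b = b' + (t : ℤ) • unitVec μ) ∧ b' ∈ ctrPts n μ y ∧ b ∈ ctrPts n μ y := by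
  obtain ⟨p, hp⟩ := Finset.card_ne_zero.mp h
  rw [mem_dotFiber] at hp
  obtain ⟨⟨h1, h2⟩, h3⟩ := hp
  have hmem := dotMap_mem μ y (mem_dotIdx.mpr ⟨h1, h2⟩)
  rw [h3, Finset.mem_product] at hmem
  refine ⟨⟨p.1.2 - p.2, by omega, ?_, ?_⟩, hmem.1, hmem.2⟩
  · have := (mem_idx_iff.mp h1).2
    omega
  · simp only [dotMap, Prod.mk.injEq] at h3
    obtain ⟨hb', hb⟩ := h3
    rw [← hb, ← hb', add_assoc, ← pt_eq_pt_add p.1.1 h2.le]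

/-- (L0′) LOCALITY RADIUS of the support: a contour point of block `y` lies in `n•y + [0, 2n−2]⁴`, i.e.
`‖b − n•y‖∞ ≤ 2n − 2` (the `μ`-coordinate offset is `x′_μ + j ≤ 2n − 2`, the others `≤ n − 1`). [folklore] -/
theorem supNorm_sub_le_of_mem_ctrPts {n : ℕ} {μ : Fin 4} {y b : Pt} (hb : b ∈ ctrPts n μ y) :
    supNorm (b - n • y) ≤ 2 * n - 2 := by
  obtain ⟨q, hq, rfl⟩ := Finset.mem_image.mp hb
  obtain ⟨hx, hs⟩ := mem_idx_iff.mp hq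
  rw [mem_fineBlock] at hx
  rw [add_sub_cancel_left, supNorm_le_iff]
  intro i
  rw [pt_apply]
  obtain ⟨h0, h1⟩ := hx i
  split_ifs <;> omega

/-! ## (L1) The `ℓ¹`-over-blocks letter -/

/-- [folklore] the sum of fibre cardinalities over blocks is ONE cardinality (of a filtered product). -/
theorem sum_card_dotFiber_eq (n : ℕ) (μ : Fin 4) (S : Finset Pt) (bb : Pt × Pt) :
    ∑ y ∈ S, (dotFiber n μ y bb).card =
      ((S ×ˢ dotIdx n).filter fun z => dotMap n μ z.1 z.2 = bb).card := by
  classical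
  rw [Finset.card_filter, Finset.sum_product]
  refine Finset.sum_congr rfl fun y _ => ?_
  rw [dotFiber, Finset.card_filter]

/-- (L1-count) `Σ_{y ∈ S} dotCount n μ y b′ b ≤ n − t` for `b = b′ + t•e_μ`: the position `j` of the insertion bond is
an INJECTIVE label of the summands and `j < n − t`. [folklore] -/
theorem sum_dotCount_le_sub {n : ℕ} (μ : Fin 4) {b' b : Pt} {t : ℕ} (ht : b = b' + (t : ℤ) • unitVec μ)
    (S : Finset Pt) : ∑ y ∈ S, dotCount n μ y b' b ≤ n - t := by
  classical
  unfold dotCount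
  rw [sum_card_dotFiber_eq]
  calc ((S ×ˢ dotIdx n).filter fun z => dotMap n μ z.1 z.2 = (b', b)).card
      ≤ (range (n - t)).card := by
        refine Finset.card_le_card_of_injOn (fun z => z.2.2) ?_ ?_
        · intro z hz
          rw [Finset.mem_coe, Finset.mem_filter, Finset.mem_product, mem_dotIdx] at hz
          obtain ⟨⟨_, h1, h2⟩, h3⟩ := hz
          simp only [dotMap, Prod.mk.injEq] at h3
          obtain ⟨hb', hb⟩ := h3
          have hs : z.2.1.2 < n := (mem_idx_iff.mp h1).2
          have e1 : b = b' + ((z.2.1.2 - z.2.2 : ℕ) : ℤ) • unitVec μ := by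
            rw [← hb, ← hb', add_assoc, ← pt_eq_pt_add z.2.1.1 h2.le]
          have e2 : (t : ℤ) = ((z.2.1.2 - z.2.2 : ℕ) : ℤ) :=
            smul_unitVec_injective (add_left_cancel (ht.symm.trans e1))
          have e3 : t = z.2.1.2 - z.2.2 := by exact_mod_cast e2
          simp only [Finset.coe_range, Set.mem_Iio]
          omega
        · intro z₁ hz₁ z₂ hz₂ hj
          rw [Finset.mem_coe, Finset.mem_filter, Finset.mem_product, mem_dotIdx] at hz₁ hz₂
          simp only [dotMap, Prod.mk.injEq] at hz₁ hz₂
          obtain ⟨⟨_, h1, _⟩, hb'₁, hb₁⟩ := hz₁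
          obtain ⟨⟨_, h2, _⟩, hb'₂, hb₂⟩ := hz₂
          simp only at hj
          have hbase : n • z₁.1 + pt μ (z₁.2.1.1, z₁.2.2) = n • z₂.1 + pt μ (z₂.2.1.1, z₁.2.2) := by
            rw [hb'₁, hj, hb'₂]
          obtain ⟨hy, hx⟩ := base_unique (mem_idx_iff.mp h1).1 (mem_idx_iff.mp h2).1 hbase
          have hq : z₁.2.1 = z₂.2.1 := by
            have h' : pt μ z₁.2.1 = pt μ z₂.2.1 := by
              have := hb₁.trans hb₂.symm
              rw [hy] at this
              exact add_left_cancel this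
            exact Prod.ext hx (pt_pos_injective hx h')
          exact Prod.ext hy (Prod.ext hq hj)
    _ = n - t := Finset.card_range _

/-- (L1-count) `Σ_{y ∈ S} dotCount n μ y b′ b ≤ n` for ALL `b′, b`. [folklore] -/
theorem sum_dotCount_le (n : ℕ) (μ : Fin 4) (b' b : Pt) (S : Finset Pt) : ∑ y ∈ S, dotCount n μ y b' b ≤ n := by
  classical
  by_cases h : ∀ y ∈ S, dotCount n μ y b' b = 0
  · rw [Finset.sum_eq_zero h]
    exact Nat.zero_le n
  · simp only [not_forall, exists_prop] at h
    obtain ⟨y, _, hy⟩ := h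
    obtain ⟨⟨t, _, _, ht⟩, _⟩ := dotCount_ne_zero_imp hy
    exact (sum_dotCount_le_sub μ ht S).trans (Nat.sub_le n t)

/-- (L1) THE `ℓ¹`-OVER-BLOCKS LETTER, sharp form: `Σ_{y∈S} q̇(y; b′, b′ + t•e_μ) ≤ (n − t)/n⁵`. [folklore] -/
theorem sum_qdot_le_sub (n : ℕ) (μ : Fin 4) {b' b : Pt} {t : ℕ} (ht : b = b' + (t : ℤ) • unitVec μ)
    (S : Finset Pt) : ∑ y ∈ S, qdot n μ y b' b ≤ ((n - t : ℕ) : ℝ) / (n : ℝ) ^ 5 := by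
  unfold qdot
  rw [← Finset.sum_div, ← Nat.cast_sum]
  exact div_le_div_of_nonneg_right (by exact_mod_cast sum_dotCount_le_sub μ ht S) (by positivity)

/-- (L1) THE `ℓ¹`-OVER-BLOCKS LETTER (the row's `Σ_u |q̇(u; b′, b)| ≤ n⁻⁴`): `Σ_{y∈S} q̇(y; b′, b) ≤ 1/n⁴` for every
finite set of blocks `S` and all `b′, b` (`q̇ ≥ 0`, part 1 `qdot_nonneg`, so no absolute value is needed). [folklore] -/
theorem sum_qdot_le {n : ℕ} (hn : 1 ≤ n) (μ : Fin 4) (b' b : Pt) (S : Finset Pt) :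
    ∑ y ∈ S, qdot n μ y b' b ≤ 1 / (n : ℝ) ^ 4 := by
  unfold qdot
  rw [← Finset.sum_div, ← Nat.cast_sum]
  have hn0 : (0 : ℝ) < n := by exact_mod_cast hn
  rw [div_le_div_iff₀ (by positivity) (by positivity)]
  calc ((∑ y ∈ S, dotCount n μ y b' b : ℕ) : ℝ) * (n : ℝ) ^ 4 ≤ (n : ℝ) * (n : ℝ) ^ 4 := by
        gcongr
        exact_mod_cast sum_dotCount_le n μ b' b S
    _ = 1 * (n : ℝ) ^ 5 := by ring

/-! ## (L2) The insertion operator-norm letters -/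

/-- [our object] the position pairs `(j, s)` with `j < s < n`. -/
def triPairs (n : ℕ) : Finset (ℕ × ℕ) := (range n ×ˢ range n).filter fun js => js.1 < js.2

/-- [folklore] `#triPairs n · 2 = n(n−1)`. -/
theorem card_triPairs_mul_two (n : ℕ) : (triPairs n).card * 2 = n * (n - 1) := by
  classical
  have h : (triPairs n).card = ∑ s ∈ range n, s := by
    rw [triPairs, Finset.card_filter, Finset.sum_product_right]
    refine Finset.sum_congr rfl fun s hs => ?_
    rw [← Finset.card_filter, filter_lt_range (mem_range.mp hs).le, card_range]
  rw [h, Finset.sum_range_id_mul_two]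

/-- [folklore] the real form: `#triPairs n ≤ n²/2`. -/
theorem card_triPairs_le (n : ℕ) : ((triPairs n).card : ℝ) ≤ (n : ℝ) ^ 2 / 2 := by
  have h := card_triPairs_mul_two n
  have h' : ((triPairs n).card : ℝ) * 2 = (n : ℝ) * ((n - 1 : ℕ) : ℝ) := by exact_mod_cast h
  have hle : ((n - 1 : ℕ) : ℝ) ≤ n := by exact_mod_cast Nat.sub_le n 1
  have hn : (0 : ℝ) ≤ n := Nat.cast_nonneg n
  nlinarith

/-- (L2-count, insertion bond `b′` fixed) `Σ_{y∈S} Σ_{b∈T} dotCount n μ y b′ b ≤ #triPairs n`: the position pair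
`(j, s)` labels the summands INJECTIVELY. [folklore] -/
theorem sum_sum_dotCount_le_left (n : ℕ) (μ : Fin 4) (b' : Pt) (S T : Finset Pt) :
    ∑ y ∈ S, ∑ b ∈ T, dotCount n μ y b' b ≤ (triPairs n).card := by
  classical
  have hcard : ∑ y ∈ S, ∑ b ∈ T, dotCount n μ y b' b =
      (((S ×ˢ T) ×ˢ dotIdx n).filter fun z => dotMap n μ z.1.1 z.2 = (b', z.1.2)).card := by
    rw [Finset.card_filter, Finset.sum_product, Finset.sum_product]
    refine Finset.sum_congr rfl fun y _ => Finset.sum_congr rfl fun b _ => ?_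
    rw [dotCount, dotFiber, Finset.card_filter]
  rw [hcard]
  refine Finset.card_le_card_of_injOn (fun z => (z.2.2, z.2.1.2)) ?_ ?_
  · intro z hz
    rw [Finset.mem_coe, Finset.mem_filter, Finset.mem_product, mem_dotIdx] at hz
    obtain ⟨⟨_, h1, h2⟩, _⟩ := hz
    have hs := (mem_idx_iff.mp h1).2
    simp only [triPairs, Finset.coe_filter, Set.mem_setOf_eq, Finset.mem_product, Finset.mem_range]
    omega
  · intro z₁ hz₁ z₂ hz₂ hjs
    rw [Finset.mem_coe, Finset.mem_filter, Finset.mem_product, mem_dotIdx] at hz₁ hz₂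
    simp only [dotMap, Prod.mk.injEq] at hz₁ hz₂ hjs
    obtain ⟨⟨_, h1, _⟩, hb'₁, hb₁⟩ := hz₁
    obtain ⟨⟨_, h2, _⟩, hb'₂, hb₂⟩ := hz₂
    obtain ⟨hj, hs⟩ := hjs
    have hbase : n • z₁.1.1 + pt μ (z₁.2.1.1, z₁.2.2) = n • z₂.1.1 + pt μ (z₂.2.1.1, z₁.2.2) := by
      rw [hb'₁, hj, hb'₂]
    obtain ⟨hy, hx⟩ := base_unique (mem_idx_iff.mp h1).1 (mem_idx_iff.mp h2).1 hbase
    have hq : z₁.2.1 = z₂.2.1 := Prod.ext hx hs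
    have hb : z₁.1.2 = z₂.1.2 := by rw [← hb₁, ← hb₂, hy, hq]
    exact Prod.ext (Prod.ext hy hb) (Prod.ext hq hj)

/-- (L2-count, field bond `b` fixed) `Σ_{y∈S} Σ_{b′∈T} dotCount n μ y b′ b ≤ #triPairs n`. [folklore] -/
theorem sum_sum_dotCount_le_right (n : ℕ) (μ : Fin 4) (b : Pt) (S T : Finset Pt) :
    ∑ y ∈ S, ∑ b' ∈ T, dotCount n μ y b' b ≤ (triPairs n).card := by
  classical
  have hcard : ∑ y ∈ S, ∑ b' ∈ T, dotCount n μ y b' b =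
      (((S ×ˢ T) ×ˢ dotIdx n).filter fun z => dotMap n μ z.1.1 z.2 = (z.1.2, b)).card := by
    rw [Finset.card_filter, Finset.sum_product, Finset.sum_product]
    refine Finset.sum_congr rfl fun y _ => Finset.sum_congr rfl fun b' _ => ?_
    rw [dotCount, dotFiber, Finset.card_filter]
  rw [hcard]
  refine Finset.card_le_card_of_injOn (fun z => (z.2.2, z.2.1.2)) ?_ ?_
  · intro z hz
    rw [Finset.mem_coe, Finset.mem_filter, Finset.mem_product, mem_dotIdx] at hz
    obtain ⟨⟨_, h1, h2⟩, _⟩ := hz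
    have hs := (mem_idx_iff.mp h1).2
    simp only [triPairs, Finset.coe_filter, Set.mem_setOf_eq, Finset.mem_product, Finset.mem_range]
    omega
  · intro z₁ hz₁ z₂ hz₂ hjs
    rw [Finset.mem_coe, Finset.mem_filter, Finset.mem_product, mem_dotIdx] at hz₁ hz₂
    simp only [dotMap, Prod.mk.injEq] at hz₁ hz₂ hjs
    obtain ⟨⟨_, h1, _⟩, hb'₁, hb₁⟩ := hz₁
    obtain ⟨⟨_, h2, _⟩, hb'₂, hb₂⟩ := hz₂
    obtain ⟨hj, hs⟩ := hjs
    have hbase : n • z₁.1.1 + pt μ (z₁.2.1.1, z₁.2.1.2) = n • z₂.1.1 + pt μ (z₂.2.1.1, z₁.2.1.2) := by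
      have e₁ : pt μ z₁.2.1 = pt μ (z₁.2.1.1, z₁.2.1.2) := rfl
      have e₂ : pt μ z₂.2.1 = pt μ (z₂.2.1.1, z₂.2.1.2) := rfl
      rw [← e₁, hb₁, hs, ← e₂, hb₂]
    obtain ⟨hy, hx⟩ := base_unique (mem_idx_iff.mp h1).1 (mem_idx_iff.mp h2).1 hbase
    have hq : z₁.2.1 = z₂.2.1 := Prod.ext hx hs
    have hb' : z₁.1.2 = z₂.1.2 := by rw [← hb'₁, ← hb'₂, hy, hx, hj]
    exact Prod.ext (Prod.ext hy hb') (Prod.ext hq hj)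

/-- [folklore] the double kernel sum is the double count over `n⁵`. -/
theorem sum_sum_qdot_eq (n : ℕ) (μ : Fin 4) (S T : Finset Pt) (f : Pt → Pt → Pt × Pt) :
    ∑ y ∈ S, ∑ c ∈ T, qdot n μ y (f y c).1 (f y c).2 =
      ((∑ y ∈ S, ∑ c ∈ T, dotCount n μ y (f y c).1 (f y c).2 : ℕ) : ℝ) / (n : ℝ) ^ 5 := by
  rw [Nat.cast_sum, Finset.sum_div]
  refine Finset.sum_congr rfl fun y _ => ?_
  rw [Nat.cast_sum, Finset.sum_div]
  rfl

/-- [folklore] arithmetic: a count `≤ n²/2` over `n⁵` is `≤ 1/(2n³)`. -/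
theorem div_pow_five_le {n : ℕ} (hn : 1 ≤ n) {k : ℝ} (hk : k ≤ (n : ℝ) ^ 2 / 2) :
    k / (n : ℝ) ^ 5 ≤ 1 / (2 * (n : ℝ) ^ 3) := by
  have hn0 : (0 : ℝ) < n := by exact_mod_cast hn
  rw [div_le_div_iff₀ (by positivity) (by positivity)]
  calc k * (2 * (n : ℝ) ^ 3) ≤ (n : ℝ) ^ 2 / 2 * (2 * (n : ℝ) ^ 3) := by gcongr
    _ = 1 * (n : ℝ) ^ 5 := by ring

/-- (L2) THE INSERTION OPERATOR-NORM LETTER, insertion bond `b′` fixed (the row's «given `b′`, fewer than `n` partners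
`b` ⟹ `n·n⁻⁴ = n⁻³`»; exact pair count `n(n−1)/2`): `Σ_{y∈S} Σ_{b∈T} q̇(y; b′, b) ≤ 1/(2n³)`. [folklore] -/
theorem sum_sum_qdot_le_left {n : ℕ} (hn : 1 ≤ n) (μ : Fin 4) (b' : Pt) (S T : Finset Pt) :
    ∑ y ∈ S, ∑ b ∈ T, qdot n μ y b' b ≤ 1 / (2 * (n : ℝ) ^ 3) := by
  have h := sum_sum_qdot_eq n μ S T (fun _ b => (b', b))
  simp only at h
  rw [h]
  refine div_pow_five_le hn ((?_ : _ ≤ ((triPairs n).card : ℝ)).trans (card_triPairs_le n))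
  exact_mod_cast sum_sum_dotCount_le_left n μ b' S T

/-- (L2) THE INSERTION OPERATOR-NORM LETTER, field bond `b` fixed: `Σ_{y∈S} Σ_{b′∈T} q̇(y; b′, b) ≤ 1/(2n³)`. [folklore] -/
theorem sum_sum_qdot_le_right {n : ℕ} (hn : 1 ≤ n) (μ : Fin 4) (b : Pt) (S T : Finset Pt) :
    ∑ y ∈ S, ∑ b' ∈ T, qdot n μ y b' b ≤ 1 / (2 * (n : ℝ) ^ 3) := by
  have h := sum_sum_qdot_eq n μ S T (fun _ b' => (b', b))
  simp only at h
  rw [h]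
  refine div_pow_five_le hn ((?_ : _ ≤ ((triPairs n).card : ℝ)).trans (card_triPairs_le n))
  exact_mod_cast sum_sum_dotCount_le_right n μ b S T

end Summit.QuantumFields.BalabanUV.Beta.FP.AveragingJetLettersBounds

end
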